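import Summits.Ventures.PackingBounds.SphericalCodes.KissingAsTouchingSpheres
import Summits.Ventures.PackingBounds.Configurations.KissingKernelBrackets
import Summits.Ventures.PackingBounds.Configurations.KissingNineteen

/-!
# How many unit spheres can touch a unit sphere in `ℝⁿ`? — the cell's kernel brackets in sphere language

Framing: lottery ticket; floor = certified bounds/negative ranges. Venture `PackingBounds` (cell `pub-packcert`), table B1.

`KissingAsTouchingSpheres` proved the `k = 0` row of SPLAG Ch. 14 Theorem 1 (`kissing_touching_isGreatest`: kissing
configurations of `ℝⁿ` = spherical codes of `ℝⁿ` with pairwise inner products `≤ 1/2`) and read the four EXACT kissing numbers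
(`ℝ³`, `ℝ⁴`, `ℝ⁸`, `ℝ²⁴`) in the wording 'exactly `N` pairwise non-overlapping unit spheres can touch a unit sphere'. This file adds
the bracket form of the dictionary (`kissing_touching_bracket`: an explicit `L`-point kissing configuration and a kernel bound `U`
for all codes give '`L` non-overlapping unit spheres CAN touch a unit sphere of `ℝⁿ`, and never more than `U`') and reads every
two-sided bracket the tree currently holds on `Config.kissingSizes n` (`Configurations/KissingBrackets.lean`,
`KissingKernelBrackets.lean`, `KissingNineteen.lean`):

| `ℝⁿ` | can touch | never more than | upper end in the kernel |
|---|---|---|---|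
| `ℝ⁵` | `40` | `44` | three-point `K5d14` (= Machado–de Oliveira's rigorous value) |
| `ℝ⁶` | `72` | `78` | three-point `K6d10` |
| `ℝ⁷` | `126` | `134` | three-point `K7d12` |
| `ℝ⁹` | `306` | `364` | three-point `K9d12` |
| `ℝ¹⁰` | `510` | `556` | three-point `K10d12` |
| `ℝ¹¹` | `592` | `873` | three-point `K11d12` |
| `ℝ¹²` | `840` | `1357` | three-point `K12d14` |
| `ℝ¹³` | `1130` | `2069` | three-point `K13d14p` |
| `ℝ¹⁴` | `1932` | `3183` | three-point `K14d14` |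
| `ℝ¹⁹` | `11948` | `25900` | Delsarte LP (Ho's 2026 configuration below) |
| `ℝ²⁰` | `19448` | `36753` | three-point `K20d14` |
| `ℝ²¹` | `29768` | `54565` | three-point `K21d14` |
| `ℝ²²` | `49896` | `82328` | three-point `K22d14` |
| `ℝ²³` | `93150` | `128095` | Delsarte LP |

The cell's exact certificates at three-point degree `16` / `17` (B1 columns `κ(12) ≤ 1356`, …, `κ(23) ≤ 122789`) are rational
certificates verified by two engines and a referee but are not kernel theorems, so they do not appear here. Mathlib-only
statements; no new mathematics (transport of existing kernel theorems).

## References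
* J. H. Conway, N. J. A. Sloane, *Sphere Packings, Lattices and Groups*, 3rd ed., Springer 1999, Ch. 1 Table 1.2 and
  Ch. 14 Theorem 1. [`ConwaySloane1999`]
* C. Bachoc, F. Vallentin, New upper bounds for kissing numbers from semidefinite programming, J. Amer. Math. Soc. 21 (2008),
  Theorem 4.2. [`BachocVallentin2007`]
-/

noncomputable section

open Finset
open scoped RealInnerProductSpace

namespace Summit.Ventures.PackingBounds.SphericalCodes

/-- **Bracket form of the `k = 0` dictionary.** If `L ∈ Config.kissingSizes n` (an explicit `L`-point kissing configuration)
and every element of `Config.kissingSizes n` is `≤ U`, then some `L` pairwise non-overlapping unit spheres of `ℝⁿ` touch one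
unit sphere, and no more than `U` ever do. [cite: ConwaySloane1999, Ch. 14 Theorem 1] -/
theorem kissing_touching_bracket {n L U : ℕ} (h : L ∈ Config.kissingSizes n ∧ ∀ N ∈ Config.kissingSizes n, N ≤ U) :
    (∃ a : EuclideanSpace ℝ (Fin n), ∃ S : Finset (EuclideanSpace ℝ (Fin n)), S.card = L ∧
        (∀ c ∈ S, ‖c - a‖ = 2) ∧ (∀ c ∈ S, ∀ c' ∈ S, c ≠ c' → 2 ≤ ‖c - c'‖)) ∧
      ∀ a : EuclideanSpace ℝ (Fin n), ∀ S : Finset (EuclideanSpace ℝ (Fin n)),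
        (∀ c ∈ S, ‖c - a‖ = 2) → (∀ c ∈ S, ∀ c' ∈ S, c ≠ c' → 2 ≤ ‖c - c'‖) → S.card ≤ U := by
  have e : (1 : ℝ) / (((0 : ℕ) : ℝ) + 2) = 1 / 2 := by norm_num
  refine ⟨?_, ?_⟩
  · obtain ⟨C, hC, h1, h2⟩ := h.1
    obtain ⟨a, -, S, hS, hS1, hS2⟩ := exists_touching_of_code (n := n) (k := 0) C h1
      (fun x hx y hy hxy => (h2 x hx y hy hxy).trans_eq e.symm)
    exact ⟨a 0, S, hS.trans hC, fun c hc => hS1 c hc 0, hS2⟩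
  · intro a S hS1 hS2
    exact touching_le_of_code_bound (n := n) (k := 0) (N := U)
      (fun C h1 h2 => h.2 _ ⟨C, rfl, h1, fun x hx y hy hxy => (h2 x hx y hy hxy).trans_eq e⟩) (fun _ => a)
      (fun i j hij => absurd (Fin.ext (by have hi := i.isLt; have hj := j.isLt; omega)) hij) S
      (fun c hc _ => hS1 c hc) hS2

/-! ## Rows (B1, every two-sided bracket held in the kernel) -/

/-- **`ℝ⁵`: `40` unit spheres can touch one, never more than `44`** (`Config.kissing_dim5_bracket_44`: `D₅`-type configuration +
kernel three-point row `K5d14`, the rigorous value of Machado–de Oliveira Filho 2018 re-certified).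
[cite: BachocVallentin2007, Theorem 4.2] [cite: ConwaySloane1999, Ch. 1 Table 1.2] -/
theorem kissing_touching_dim5_bracket :
    (∃ a : EuclideanSpace ℝ (Fin 5), ∃ S : Finset (EuclideanSpace ℝ (Fin 5)), S.card = 40 ∧
        (∀ c ∈ S, ‖c - a‖ = 2) ∧ (∀ c ∈ S, ∀ c' ∈ S, c ≠ c' → 2 ≤ ‖c - c'‖)) ∧
      ∀ a : EuclideanSpace ℝ (Fin 5), ∀ S : Finset (EuclideanSpace ℝ (Fin 5)),
        (∀ c ∈ S, ‖c - a‖ = 2) → (∀ c ∈ S, ∀ c' ∈ S, c ≠ c' → 2 ≤ ‖c - c'‖) → S.card ≤ 44 :=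
  kissing_touching_bracket Config.kissing_dim5_bracket_44

/-- **`ℝ⁶`: `72` can touch, never more than `78`** (`Config.kissing_dim6_bracket_78`; `E₆`-type configuration + kernel three-point
row). [cite: BachocVallentin2007, Theorem 4.2] [cite: ConwaySloane1999, Ch. 1 Table 1.2] -/
theorem kissing_touching_dim6_bracket :
    (∃ a : EuclideanSpace ℝ (Fin 6), ∃ S : Finset (EuclideanSpace ℝ (Fin 6)), S.card = 72 ∧
        (∀ c ∈ S, ‖c - a‖ = 2) ∧ (∀ c ∈ S, ∀ c' ∈ S, c ≠ c' → 2 ≤ ‖c - c'‖)) ∧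
      ∀ a : EuclideanSpace ℝ (Fin 6), ∀ S : Finset (EuclideanSpace ℝ (Fin 6)),
        (∀ c ∈ S, ‖c - a‖ = 2) → (∀ c ∈ S, ∀ c' ∈ S, c ≠ c' → 2 ≤ ‖c - c'‖) → S.card ≤ 78 :=
  kissing_touching_bracket Config.kissing_dim6_bracket_78

/-- **`ℝ⁷`: `126` can touch, never more than `134`** (`Config.kissing_dim7_bracket_134`; `E₇`-type configuration + kernel
three-point row). [cite: BachocVallentin2007, Theorem 4.2] [cite: ConwaySloane1999, Ch. 1 Table 1.2] -/
theorem kissing_touching_dim7_bracket :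
    (∃ a : EuclideanSpace ℝ (Fin 7), ∃ S : Finset (EuclideanSpace ℝ (Fin 7)), S.card = 126 ∧
        (∀ c ∈ S, ‖c - a‖ = 2) ∧ (∀ c ∈ S, ∀ c' ∈ S, c ≠ c' → 2 ≤ ‖c - c'‖)) ∧
      ∀ a : EuclideanSpace ℝ (Fin 7), ∀ S : Finset (EuclideanSpace ℝ (Fin 7)),
        (∀ c ∈ S, ‖c - a‖ = 2) → (∀ c ∈ S, ∀ c' ∈ S, c ≠ c' → 2 ≤ ‖c - c'‖) → S.card ≤ 134 :=
  kissing_touching_bracket Config.kissing_dim7_bracket_134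

/-- **`ℝ⁹`: `306` can touch, never more than `364`** (`Config.kissing_dim9_bracket_364`; Construction A + kernel three-point
row `K9d12`). [cite: BachocVallentin2007, Theorem 4.2] [cite: ConwaySloane1999, Ch. 1 Table 1.2] -/
theorem kissing_touching_dim9_bracket :
    (∃ a : EuclideanSpace ℝ (Fin 9), ∃ S : Finset (EuclideanSpace ℝ (Fin 9)), S.card = 306 ∧
        (∀ c ∈ S, ‖c - a‖ = 2) ∧ (∀ c ∈ S, ∀ c' ∈ S, c ≠ c' → 2 ≤ ‖c - c'‖)) ∧
      ∀ a : EuclideanSpace ℝ (Fin 9), ∀ S : Finset (EuclideanSpace ℝ (Fin 9)),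
        (∀ c ∈ S, ‖c - a‖ = 2) → (∀ c ∈ S, ∀ c' ∈ S, c ≠ c' → 2 ≤ ‖c - c'‖) → S.card ≤ 364 :=
  kissing_touching_bracket Config.kissing_dim9_bracket_364

/-- **`ℝ¹⁰`: `510` can touch, never more than `556`** (`Config.kissing_dim10_bracket_556`; Ganzhinov's `510` + kernel
three-point row `K10d12`). [cite: BachocVallentin2007, Theorem 4.2] [cite: ConwaySloane1999, Ch. 1 Table 1.2] -/
theorem kissing_touching_dim10_bracket :
    (∃ a : EuclideanSpace ℝ (Fin 10), ∃ S : Finset (EuclideanSpace ℝ (Fin 10)), S.card = 510 ∧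
        (∀ c ∈ S, ‖c - a‖ = 2) ∧ (∀ c ∈ S, ∀ c' ∈ S, c ≠ c' → 2 ≤ ‖c - c'‖)) ∧
      ∀ a : EuclideanSpace ℝ (Fin 10), ∀ S : Finset (EuclideanSpace ℝ (Fin 10)),
        (∀ c ∈ S, ‖c - a‖ = 2) → (∀ c ∈ S, ∀ c' ∈ S, c ≠ c' → 2 ≤ ‖c - c'‖) → S.card ≤ 556 :=
  kissing_touching_bracket Config.kissing_dim10_bracket_556

/-- **`ℝ¹¹`: `592` can touch, never more than `873`** (`Config.kissing_dim11_bracket_873`; kernel three-point row `K11d12`).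
[cite: BachocVallentin2007, Theorem 4.2] [cite: ConwaySloane1999, Ch. 1 Table 1.2] -/
theorem kissing_touching_dim11_bracket :
    (∃ a : EuclideanSpace ℝ (Fin 11), ∃ S : Finset (EuclideanSpace ℝ (Fin 11)), S.card = 592 ∧
        (∀ c ∈ S, ‖c - a‖ = 2) ∧ (∀ c ∈ S, ∀ c' ∈ S, c ≠ c' → 2 ≤ ‖c - c'‖)) ∧
      ∀ a : EuclideanSpace ℝ (Fin 11), ∀ S : Finset (EuclideanSpace ℝ (Fin 11)),
        (∀ c ∈ S, ‖c - a‖ = 2) → (∀ c ∈ S, ∀ c' ∈ S, c ≠ c' → 2 ≤ ‖c - c'‖) → S.card ≤ 873 :=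
  kissing_touching_bracket Config.kissing_dim11_bracket_873

/-- **`ℝ¹²`: `840` can touch, never more than `1357`** (`Config.kissing_dim12_bracket_1357`; kernel three-point row `K12d14`).
[cite: BachocVallentin2007, Theorem 4.2] [cite: ConwaySloane1999, Ch. 1 Table 1.2] -/
theorem kissing_touching_dim12_bracket :
    (∃ a : EuclideanSpace ℝ (Fin 12), ∃ S : Finset (EuclideanSpace ℝ (Fin 12)), S.card = 840 ∧
        (∀ c ∈ S, ‖c - a‖ = 2) ∧ (∀ c ∈ S, ∀ c' ∈ S, c ≠ c' → 2 ≤ ‖c - c'‖)) ∧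
      ∀ a : EuclideanSpace ℝ (Fin 12), ∀ S : Finset (EuclideanSpace ℝ (Fin 12)),
        (∀ c ∈ S, ‖c - a‖ = 2) → (∀ c ∈ S, ∀ c' ∈ S, c ≠ c' → 2 ≤ ‖c - c'‖) → S.card ≤ 1357 :=
  kissing_touching_bracket Config.kissing_dim12_bracket_1357

/-- **`ℝ¹³`: `1130` can touch, never more than `2069`** (`Config.kissing_dim13_bracket_2069`; kernel three-point row `K13d14p`).
[cite: BachocVallentin2007, Theorem 4.2] [cite: ConwaySloane1999, Ch. 1 Table 1.2] -/
theorem kissing_touching_dim13_bracket :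
    (∃ a : EuclideanSpace ℝ (Fin 13), ∃ S : Finset (EuclideanSpace ℝ (Fin 13)), S.card = 1130 ∧
        (∀ c ∈ S, ‖c - a‖ = 2) ∧ (∀ c ∈ S, ∀ c' ∈ S, c ≠ c' → 2 ≤ ‖c - c'‖)) ∧
      ∀ a : EuclideanSpace ℝ (Fin 13), ∀ S : Finset (EuclideanSpace ℝ (Fin 13)),
        (∀ c ∈ S, ‖c - a‖ = 2) → (∀ c ∈ S, ∀ c' ∈ S, c ≠ c' → 2 ≤ ‖c - c'‖) → S.card ≤ 2069 :=
  kissing_touching_bracket Config.kissing_dim13_bracket_2069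

/-- **`ℝ¹⁴`: `1932` can touch, never more than `3183`** (`Config.kissing_dim14_bracket_3183`; Ganzhinov's `1932` + kernel
three-point row `K14d14`). [cite: BachocVallentin2007, Theorem 4.2] [cite: ConwaySloane1999, Ch. 1 Table 1.2] -/
theorem kissing_touching_dim14_bracket :
    (∃ a : EuclideanSpace ℝ (Fin 14), ∃ S : Finset (EuclideanSpace ℝ (Fin 14)), S.card = 1932 ∧
        (∀ c ∈ S, ‖c - a‖ = 2) ∧ (∀ c ∈ S, ∀ c' ∈ S, c ≠ c' → 2 ≤ ‖c - c'‖)) ∧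
      ∀ a : EuclideanSpace ℝ (Fin 14), ∀ S : Finset (EuclideanSpace ℝ (Fin 14)),
        (∀ c ∈ S, ‖c - a‖ = 2) → (∀ c ∈ S, ∀ c' ∈ S, c ≠ c' → 2 ≤ ‖c - c'‖) → S.card ≤ 3183 :=
  kissing_touching_bracket Config.kissing_dim14_bracket_3183

/-- **`ℝ¹⁹`: `11948` can touch, never more than `25900`** (`Config.Leech.kissing_dim19_ho_bracket`: Ho's 2026 configuration +
the kernel Delsarte LP bound). [cite: ConwaySloane1999, Ch. 1 Table 1.2] -/
theorem kissing_touching_dim19_bracket :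
    (∃ a : EuclideanSpace ℝ (Fin 19), ∃ S : Finset (EuclideanSpace ℝ (Fin 19)), S.card = 11948 ∧
        (∀ c ∈ S, ‖c - a‖ = 2) ∧ (∀ c ∈ S, ∀ c' ∈ S, c ≠ c' → 2 ≤ ‖c - c'‖)) ∧
      ∀ a : EuclideanSpace ℝ (Fin 19), ∀ S : Finset (EuclideanSpace ℝ (Fin 19)),
        (∀ c ∈ S, ‖c - a‖ = 2) → (∀ c ∈ S, ∀ c' ∈ S, c ≠ c' → 2 ≤ ‖c - c'‖) → S.card ≤ 25900 :=
  kissing_touching_bracket ⟨Config.Leech.kissing_dim19_ho_bracket.1,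
    fun _ ⟨C, hC, h1, h2⟩ => hC ▸ Config.Leech.kissing_dim19_ho_bracket.2 C h1 h2⟩

/-- **`ℝ²⁰`: `19448` can touch, never more than `36753`** (`Config.kissing_dim20_bracket_36753`; Cohn–Li configuration + kernel
three-point row `K20d14`). [cite: BachocVallentin2007, Theorem 4.2] [cite: ConwaySloane1999, Ch. 1 Table 1.2] -/
theorem kissing_touching_dim20_bracket :
    (∃ a : EuclideanSpace ℝ (Fin 20), ∃ S : Finset (EuclideanSpace ℝ (Fin 20)), S.card = 19448 ∧
        (∀ c ∈ S, ‖c - a‖ = 2) ∧ (∀ c ∈ S, ∀ c' ∈ S, c ≠ c' → 2 ≤ ‖c - c'‖)) ∧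
      ∀ a : EuclideanSpace ℝ (Fin 20), ∀ S : Finset (EuclideanSpace ℝ (Fin 20)),
        (∀ c ∈ S, ‖c - a‖ = 2) → (∀ c ∈ S, ∀ c' ∈ S, c ≠ c' → 2 ≤ ‖c - c'‖) → S.card ≤ 36753 :=
  kissing_touching_bracket Config.kissing_dim20_bracket_36753

/-- **`ℝ²¹`: `29768` can touch, never more than `54565`** (`Config.kissing_dim21_bracket_54565`; Cohn–Li configuration + kernel
three-point row `K21d14`). [cite: BachocVallentin2007, Theorem 4.2] [cite: ConwaySloane1999, Ch. 1 Table 1.2] -/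
theorem kissing_touching_dim21_bracket :
    (∃ a : EuclideanSpace ℝ (Fin 21), ∃ S : Finset (EuclideanSpace ℝ (Fin 21)), S.card = 29768 ∧
        (∀ c ∈ S, ‖c - a‖ = 2) ∧ (∀ c ∈ S, ∀ c' ∈ S, c ≠ c' → 2 ≤ ‖c - c'‖)) ∧
      ∀ a : EuclideanSpace ℝ (Fin 21), ∀ S : Finset (EuclideanSpace ℝ (Fin 21)),
        (∀ c ∈ S, ‖c - a‖ = 2) → (∀ c ∈ S, ∀ c' ∈ S, c ≠ c' → 2 ≤ ‖c - c'‖) → S.card ≤ 54565 :=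
  kissing_touching_bracket Config.kissing_dim21_bracket_54565

/-- **`ℝ²²`: `49896` can touch, never more than `82328`** (`Config.kissing_dim22_bracket_82328`; `Λ₂₂ ⊂` Leech + kernel
three-point row `K22d14`). [cite: BachocVallentin2007, Theorem 4.2] [cite: ConwaySloane1999, Ch. 1 Table 1.2] -/
theorem kissing_touching_dim22_bracket :
    (∃ a : EuclideanSpace ℝ (Fin 22), ∃ S : Finset (EuclideanSpace ℝ (Fin 22)), S.card = 49896 ∧
        (∀ c ∈ S, ‖c - a‖ = 2) ∧ (∀ c ∈ S, ∀ c' ∈ S, c ≠ c' → 2 ≤ ‖c - c'‖)) ∧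
      ∀ a : EuclideanSpace ℝ (Fin 22), ∀ S : Finset (EuclideanSpace ℝ (Fin 22)),
        (∀ c ∈ S, ‖c - a‖ = 2) → (∀ c ∈ S, ∀ c' ∈ S, c ≠ c' → 2 ≤ ‖c - c'‖) → S.card ≤ 82328 :=
  kissing_touching_bracket Config.kissing_dim22_bracket_82328

/-- **`ℝ²³`: `93150` can touch, never more than `128095`** (`Config.kissing_dim23_bracket`: Leech section + the kernel Delsarte LP
bound). [cite: ConwaySloane1999, Ch. 1 Table 1.2] -/
theorem kissing_touching_dim23_bracket :
    (∃ a : EuclideanSpace ℝ (Fin 23), ∃ S : Finset (EuclideanSpace ℝ (Fin 23)), S.card = 93150 ∧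
        (∀ c ∈ S, ‖c - a‖ = 2) ∧ (∀ c ∈ S, ∀ c' ∈ S, c ≠ c' → 2 ≤ ‖c - c'‖)) ∧
      ∀ a : EuclideanSpace ℝ (Fin 23), ∀ S : Finset (EuclideanSpace ℝ (Fin 23)),
        (∀ c ∈ S, ‖c - a‖ = 2) → (∀ c ∈ S, ∀ c' ∈ S, c ≠ c' → 2 ≤ ‖c - c'‖) → S.card ≤ 128095 :=
  kissing_touching_bracket Config.kissing_dim23_bracket

end Summit.Ventures.PackingBounds.SphericalCodes
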